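import Literature.NumberTheory.Automorphic.ReciprocityGLnPatchingGalois
import Literature.NumberTheory.Automorphic.AutomorphicRepsGLSatakeFlathProofs
import Literature.NumberTheory.GaloisRepresentations.ArtinReciprocityCharacterProofs
import Literature.NumberTheory.GaloisRepresentations.ResidualPairIntegrality
import Summits.Langlands.Langlands.Theses.QuadraticWindow
import Mathlib.RingTheory.DedekindDomain.Different
import Mathlib.NumberTheory.RamificationInertia.Unramified
import HarnessLib

/-!
# Patching over the CM family `F₀(√-D)` — stub `stub_patch` of line `one-transparent-pane`
(crux `Summit.Langlands.Langlands.Theses.QuadraticWindow.HostInducedRep`, item stmt-Langlands-10902)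

LOG (worker, 2026-08-16).  Verdict on the REGISTERED signature (skeleton ll. 357–395: an ABSTRACT
family `K_j/F₀`, control only above good places SPLIT in `K_j`): true in nature, not provable with
the tree — Sorensen's hypotheses (a) `r_j^σ ≃ r_j`, (b) `r_i ≃ r_j` on `Γ_{K_i} ∩ Γ_{K_j}` must come
from equal Frobenius polynomials, and the tree's criteria (`CompatibleAE.nonempty_equiv(_outerConj)`,
`GoodPrime.exists_conj`, existence-form Chebotarev `chebotarev_artinRep_holds`) need agreement at
COFINITELY many places of `K_j`, not only above split `v`; the density-one substitute
(`FrobeniusDensityOneProofs`: closed power-stable sets containing the Frobenii over ALL places of a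
density-one set) would have to be re-proved for "all degree-one places", and (b) needs composita
`K_iK_j` of abstract types with both towers — far beyond a stub.  Hence `stub-misstated`; corrected
signature = `stub_patch` below (the lead's target shape): the CONCRETE `∅`-general family
`F₀(√-D)`, `D ∈ QuadraticFamily.GoodPrime F₀ m B`,
control ALMOST EVERYWHERE on each member (every splitting type — what F–P 9.10 plus an a.e.
Satake dictionary gives), coverage at ONE place above each good `v` (as registered; weaker than
the lead's draft).  Proved UNCONDITIONALLY: rc 0, 0 warnings, 0 sorries, axioms
`propext, Classical.choice, Quot.sound`.  For the re-composition: members are CM by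
`QuadraticFamily.GoodPrime.isCMField (Or.inl hTR)`, quadratic (`finrank_sqrtNegField`), Galois
(`inferInstance`); a leaner DATUM FORM of the stub is `exists_framedGaloisRep_of_compatibleAE_readOff`
(every `r_D` `PatchingFamily.CompatibleAE` with ONE Frobenius datum `E` on `F₀` ⇒ patched `R`,
read off at any single place above a split place).  DRY-RUN (`--kind proof --target
Summits/Langlands/Langlands/Theorems/QuadraticWindowHostInducedRepPatch.lean --supports stmt-Langlands-10902`,
final file, 2026-08-16T04:15Z): "would-be verdict: ACCEPT [stage route] codes=- … note: disables a
linter (lint debt)" (`dupNamespace`, as in the landed siblings).  NOT proposed for real (lead re-registers).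

Statement (`stub_patch`).  `F/F₀` number fields, `π` cuspidal on `GL_n/F`, `ℓ`, `ι : ℚ̄_ℓ ≃ ℂ`,
`eψ : Γ_F → GL_1(ℂ)`, `m ≠ 0`, `B` finite, `r_D : Γ_{F₀(√-D)} → GL_{2n}(ℚ̄_ℓ)` continuous with
semisimple underlying representations (`D ∈ GoodPrime F₀ m B`).  `Guard_v(α,c)`: every `w ∣ v` has
`e(w∣v) = 1`, `π` has Satake parameter `α_w` at `w`, `eψ` is unramified at `w` with Frobenius value
`c_w`; `H_v(α,c) = ∏ᶠ_{w∣v} expand^{f(w∣v)} arithFrobPolyOfSatake ι q_w n (α_w c_w)` (the crux's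
host polynomial).  IF (control a.e.) for every `D`, at all but finitely many places `u` of
`F₀(√-D)`, for all `(α,c)` with `v = u ∩ F₀ ∤ ℓ`, `Guard_v(α,c)`: `r_D` is unramified at `u` with
`charpoly = ∏_{x ∈ roots H_v(α,c)} (X - x^{f(u∣v)})`; and (coverage) every `v ∤ ℓ` with
`Guard_v(α,c)` splits in some member with `r_D` unramified, `charpoly = H_v(α,c)`, at SOME `u ∣ v`
— THEN some continuous `R : Γ_{F₀} → GL_{2n}(ℚ̄_ℓ)` with semisimple underlying representation is
unramified with `charpoly = H_v(α,c)` at every `v ∤ ℓ` with `Guard_v(α,c)` (the crux's conclusion).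

Proof.  (1) Guard families exist at all but finitely many `v` (`eventually_exists_guard`: places
above `ℓ`; below the finitely many places of `F` ramified over `F₀` — different —, without Satake
parameter — Flath, `hasSatakeParamAt_cofinite_holds` —, or ramified for `eψ` — finite image,
`FramedArtinRep.eventually_isUnramifiedAt`; Frobenius values by `exists_hasFrobCharpolyAt_X_sub_C`).
(2) Choose a guard family `(α⁰_v, c⁰_v)` wherever one exists; `E(v) := roots H_v(α⁰_v, c⁰_v)`;
by control and (1), every `r_D` is `CompatibleAE E` (finitely many places lie above finitely many).
(3) Sorensen's Lemma 2 over the `∅`-general family (`GoodPrime.exists_framedGaloisRep`; (a), (b)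
from `CompatibleAE` by Chebotarev + Brauer–Nesbitt, all proved in the tree) gives `R` with
`R|_{Γ_{F₀(√-D)}} ≃ r_D`.  (4) Read-off at ONE place (§1–§2): at a good `v`, coverage gives a
member with `v` split (`e = f = 1`) and one `u ∣ v` where `r_D ≃ R|` is unramified with the host
polynomial; inertia above `u` lies in `Γ_{F₀(√-D)}` and the primes above `v` are conjugate, so `R`
is unramified at `v`; a Frobenius above `u` restricts to one above `v` (`f = 1`).

References: Sorensen, *A patching lemma*, LMS LNS 457 (2020), §1 Lemma 2 [Sorensen2020];
Harris–Taylor, Ann. of Math. Stud. 151 (2001), proof of Thm. VII.1.9 [HarrisTaylorAMS2001];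
Harris–Lan–Taylor–Thorne, Res. Math. Sci. 3:37 (2016), proof of Cor. 7.14 [HarrisLanTaylorThorneRMS2016];
Neukirch, *Algebraic Number Theory*, I §9 [NeukirchANT1999]; Serre, *Abelian ℓ-adic representations*, I §2.1.
-/

set_option linter.dupNamespace false -- project-wide option (lakefile weak.linter.dupNamespace); `Summit.Langlands.Langlands` is the mandated namespace

open Literature.NumberTheory.GaloisRepresentations Literature.NumberTheory.Automorphic
open Literature.NumberTheory.GaloisRepresentations.QuadraticFamily
open Literature.NumberTheory.Automorphic.PatchingFamily
open IsDedekindDomain NumberField Filter Polynomial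

namespace Summit.Langlands.Langlands.Theorems.HostInducedRep.OneTransparentPane

/-! ### §1 Read-off at ONE place: unramifiedness and Frobenius polynomials descend from `Γ_M` -/

section ReadOff

variable {F M : Type*} [Field F] [NumberField F] [Field M] [NumberField M] [Algebra F M]
  {A : Type*} [CommRing A] [TopologicalSpace A] {n : ℕ}

omit [NumberField M] in
/-- **One prime above `v` suffices for unramifiedness** (framed form): if `σ` kills the inertia
group of one prime `𝔓 ∣ v` of `\bar ℤ_F`, it is unramified at `v` — every other prime above `v`
is `τ • 𝔓` (`exists_smul_eq_of_mem_primesAbove_holds`) and `I_{τ • 𝔓} = τ I_𝔓 τ⁻¹`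
(`Ideal.conj_mem_inertia_smul_iff`).  Serre, *Abelian ℓ-adic representations*, I §2.1. [folklore] -/
theorem isUnramifiedAt_of_forall_mem_inertia {σ : FramedGaloisRep F A n}
    {v : HeightOneSpectrum (𝓞 F)} {𝔓 : Ideal (absIntegers (𝓞 F) F)} (h𝔓 : 𝔓 ∈ v.primesAbove)
    (h : ∀ g ∈ 𝔓.inertia (Field.absoluteGaloisGroup F), σ g = 1) : σ.IsUnramifiedAt v := by
  intro 𝔓' h𝔓' g hg
  obtain ⟨τ, rfl⟩ := HeightOneSpectrum.exists_smul_eq_of_mem_primesAbove_holds h𝔓 h𝔓'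
  have hg_eq : g = τ * (τ⁻¹ * g * τ) * τ⁻¹ := by group
  have hg' : τ⁻¹ * g * τ ∈ 𝔓.inertia (Field.absoluteGaloisGroup F) := by
    rwa [← Ideal.conj_mem_inertia_smul_iff 𝔓 τ, ← hg_eq]
  rw [hg_eq, map_mul, map_mul, h _ hg', mul_one, ← map_mul, mul_inv_cancel, map_one]

/-- **Unramifiedness descends from `Γ_M` through ONE place.**  `M/F` finite Galois, `v`
unramified in `M` (`e(v) = 1`), `w ∣ v` a place of `M`, and `σ|_{Γ_M}` unramified at `w`: then
`σ : Γ_F → GL_n(A)` is unramified at `v`.  Take a prime `𝔔 ∣ w` of `\bar ℤ_M` and the prime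
`𝔓 = ι⁻¹ 𝔔 ∣ v` below it (`comap_absIntegersMap_mem_primesAbove`); `I_𝔓 ≤ res(Γ_M)`
(`inertia_le_range_absGaloisRestrict`) and `res⁻¹(I_𝔓) = I_𝔔` (`comap_inertia_comap_absIntegersMap`),
so `σ(I_𝔓) = σ|_{Γ_M}(I_𝔔) = 1`, and one prime suffices (`isUnramifiedAt_of_forall_mem_inertia`).
One-place sharpening of the tree's `FramedGaloisRep.isUnramifiedAt_of_restrictField`.
Neukirch, *Algebraic Number Theory*, Ch. I §9, (9.4)–(9.6). [folklore] -/
theorem isUnramifiedAt_of_restrictField_of_under_eq [IsGalois F M] (σ : FramedGaloisRep F A n)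
    {v : HeightOneSpectrum (𝓞 F)} (he : v.asIdeal.ramificationIdxIn (𝓞 M) = 1)
    {w : HeightOneSpectrum (𝓞 M)} (hw : w.asIdeal.under (𝓞 F) = v.asIdeal)
    (h : (σ.restrictField M).IsUnramifiedAt w) : σ.IsUnramifiedAt v := by
  -- adapted from Literature/NumberTheory/Automorphic/ReciprocityGLnDescentProofs.lean
  obtain ⟨𝔔, h𝔔⟩ := w.primesAbove_nonempty
  have h𝔓 := comap_absIntegersMap_mem_primesAbove (K := F) hw h𝔔
  refine isUnramifiedAt_of_forall_mem_inertia h𝔓 fun γ hγ ↦ ?_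
  obtain ⟨δ, rfl⟩ := inertia_le_range_absGaloisRestrict F M he h𝔓 hγ
  have hδ : δ ∈ 𝔔.inertia (Field.absoluteGaloisGroup M) := by
    rw [← comap_inertia_comap_absIntegersMap F M 𝔔, Subgroup.mem_comap]
    exact hγ
  have h1 := h 𝔔 h𝔔 δ hδ
  rwa [FramedGaloisRep.restrictField_apply] at h1

/-- **Frobenius characteristic polynomials descend from `Γ_M` through ONE place of residue
degree one.**  If `σ : Γ_F → GL_n(A)` is unramified at `v`, `w ∣ v` has `f(w∣v) = 1` and
`σ|_{Γ_M}` has arithmetic-Frobenius characteristic polynomial `P` at `w`, then `σ` has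
arithmetic-Frobenius characteristic polynomial `P` at `v`: for a Frobenius `τ ∈ Γ_M` at `𝔔 ∣ w`,
`res τ` is a Frobenius at `ι⁻¹ 𝔔 ∣ v` (`isArithFrobAt_absGaloisRestrict_of_inertiaDeg_eq_one`)
with `charpoly σ(res τ) = P`, and at an unramified place the characteristic polynomial of one
Frobenius is that of all (`FramedGaloisRep.IsUnramifiedAt.hasFrobCharpolyAt_charpoly`).
One-place sharpening of the tree's `FramedGaloisRep.hasFrobCharpolyAt_of_restrictField`.
Neukirch, Ch. I §9, (9.4)–(9.5); Serre, Ch. I §2.1. [folklore] -/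
theorem hasFrobCharpolyAt_of_restrictField_of_under_eq [IsTopologicalRing A]
    [Algebra.IsAlgebraic F M] (σ : FramedGaloisRep F A n) {v : HeightOneSpectrum (𝓞 F)}
    (hσ : σ.IsUnramifiedAt v) {w : HeightOneSpectrum (𝓞 M)}
    (hw : w.asIdeal.under (𝓞 F) = v.asIdeal) (hf : w.asIdeal.inertiaDeg (𝓞 F) = 1)
    {P : A[X]} (h : (σ.restrictField M).HasFrobCharpolyAt w P) : σ.HasFrobCharpolyAt v P := by
  obtain ⟨𝔔, h𝔔⟩ := w.primesAbove_nonempty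
  have h𝔓 := comap_absIntegersMap_mem_primesAbove (K := F) hw h𝔔
  obtain ⟨τ, hτ⟩ := HeightOneSpectrum.exists_isArithFrobAt_of_mem_primesAbove_holds h𝔔
  have hres := isArithFrobAt_absGaloisRestrict_of_inertiaDeg_eq_one hw h𝔔 hτ hf
  have h2 : FramedRep.charpoly σ (absGaloisRestrict F M τ) = P := h 𝔔 h𝔔 τ hτ
  exact h2 ▸ hσ.hasFrobCharpolyAt_charpoly h𝔓 hres

end ReadOff

/-! ### §2 Patching over the family `F₀(√-D)` and reading off at one split place -/

/-- **Sorensen patching over the `∅`-general family `K(√-D)`, with read-off at ONE place above a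
split place.**  Let `ρ_D : Γ_{K(√-D)} → GL_N(k)` (`D ∈ GoodPrime K m B`) be continuous with
semisimple underlying representations, all compatible almost everywhere with one Frobenius datum
`E` on `K` (`PatchingFamily.CompatibleAE`).  Then there is a continuous `R : Γ_K → GL_N(k)` with
semisimple underlying representation and `R|_{Γ_{K(√-D)}} ≃ ρ_D` for every member
(`GoodPrime.exists_framedGaloisRep` — Sorensen's Lemma 2, hypotheses (a), (b) by Chebotarev +
Brauer–Nesbitt: `CompatibleAE.nonempty_equiv_outerConj`, `GoodPrime.exists_conj`), and for every
member `D`, every `v` split in `K(√-D)` and every SINGLE place `u ∣ v` at which `ρ_D` is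
unramified with Frobenius characteristic polynomial `Q`, `R` is unramified at `v` with Frobenius
characteristic polynomial `Q` (`e = f = 1`, `ramificationIdxIn_eq_one_of_ncard_eq_finrank`;
transfer along `R| ≃ ρ_D` by `isUnramifiedAt_of_equiv`, `hasFrobCharpolyAt_of_equiv`; descent
through the one place `u`, §1).  Sharpens the tree's `GoodPrime.exists_framedGaloisRep_of_compatibleAE`
(control at BOTH places above `v`); Harris–Taylor's "`y` splits as `y'y''` in `LA` …
`[R_l(Π)|_{W_{F_y}}] = [r_l(ı⁻¹Π_y)]`" reads one place only.
[cite: Sorensen2020, §1 Lemma 2] [cite: HarrisTaylorAMS2001, proof of Thm. VII.1.9 (pp. 229–232)] -/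
theorem exists_framedGaloisRep_of_compatibleAE_readOff
    {K : Type} [Field K] [NumberField K] {m : ℕ} {B : Set ℕ} (hm : m ≠ 0) (hB : B.Finite)
    {k : Type*} [Field k] [TopologicalSpace k] [IsTopologicalRing k] [T2Space k] [CharZero k]
    {N : ℕ} (E : HeightOneSpectrum (𝓞 K) → Multiset k)
    (ρ : ∀ D : GoodPrime K m B, FramedGaloisRep (sqrtNegField K D.1) k N)
    (hss : ∀ D, (ρ D).toGaloisRep.IsSemisimple) (hE : ∀ D, CompatibleAE E (ρ D)) :
    ∃ R : FramedGaloisRep K k N, R.toGaloisRep.IsSemisimple ∧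
      (∀ D, Nonempty (ContinuousRep.Equiv
        (R.restrictField (sqrtNegField K D.1)).toGaloisRep (ρ D).toGaloisRep)) ∧
      ∀ (D : GoodPrime K m B) (v : HeightOneSpectrum (𝓞 K))
        (u : HeightOneSpectrum (𝓞 (sqrtNegField K D.1))) (Q : k[X]),
        (v.asIdeal.primesOver (𝓞 (sqrtNegField K D.1))).ncard = 2 → u.under (𝓞 K) = v →
        (ρ D).IsUnramifiedAt u → (ρ D).HasFrobCharpolyAt u Q →
          R.IsUnramifiedAt v ∧ R.HasFrobCharpolyAt v Q := by
  obtain ⟨R, hRss, hR⟩ := GoodPrime.exists_framedGaloisRep hm hB ρ hss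
    (fun i τ ↦ (hE i).nonempty_equiv_outerConj (hss i) τ)
    (fun i j ↦ GoodPrime.exists_conj i j (hss i) (hss j) (hE i) (hE j))
  refine ⟨R, hRss, hR, fun D v u Q hsplit huv hunr hQ ↦ ?_⟩
  have hsplit' : (v.asIdeal.primesOver (𝓞 (sqrtNegField K D.1))).ncard =
      Module.finrank K (sqrtNegField K D.1) := by
    rw [finrank_sqrtNegField]
    exact hsplit
  obtain ⟨he, hf⟩ := ramificationIdxIn_eq_one_of_ncard_eq_finrank v hsplit'
  set e := (Classical.choice (hR D)).symm
  have huv' : u.asIdeal.under (𝓞 K) = v.asIdeal := by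
    rw [← huv]
    rfl
  have hfu : u.asIdeal.inertiaDeg (𝓞 K) = 1 := by rw [inertiaDeg_eq_inertiaDegIn huv', hf]
  have hunrR : R.IsUnramifiedAt v :=
    isUnramifiedAt_of_restrictField_of_under_eq R he huv'
      (FramedGaloisRep.isUnramifiedAt_of_equiv e hunr)
  exact ⟨hunrR, hasFrobCharpolyAt_of_restrictField_of_under_eq R hunrR huv' hfu
    (FramedGaloisRep.hasFrobCharpolyAt_of_equiv e hQ)⟩

/-! ### §3 Guard data exist at all but finitely many places -/

section Guard

variable {K : Type} [Field K] [NumberField K] {A : Type*} [CommRing A] [TopologicalSpace A]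

omit [NumberField K] in
/-- In rank one the characteristic polynomial is `X - C (the entry)`. [folklore] -/
theorem charpoly_rankOne (ρ : FramedGaloisRep K A 1) (σ : Field.absoluteGaloisGroup K) :
    FramedRep.charpoly ρ σ = X - C (((ρ σ : GL (Fin 1) A) : Matrix (Fin 1) (Fin 1) A) 0 0) := by
  -- adapted from Cruxes/HostInducedRep/Disproof.lean §2 (`charpoly_rankOne`)
  rw [FramedRep.charpoly, Matrix.charpoly, Matrix.det_fin_one, Matrix.charmatrix_apply_eq]

/-- A rank-one representation unramified at `w` has a Frobenius value there: some `c` with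
`ρ.HasFrobCharpolyAt w (X - C c)` (the entry of `ρ` at any arithmetic Frobenius above `w`,
`FramedGaloisRep.IsUnramifiedAt.hasFrobCharpolyAt_charpoly`). [folklore] -/
theorem exists_hasFrobCharpolyAt_X_sub_C [IsTopologicalRing A] {w : HeightOneSpectrum (𝓞 K)}
    {ρ : FramedGaloisRep K A 1} (h : ρ.IsUnramifiedAt w) :
    ∃ c : A, ρ.HasFrobCharpolyAt w (X - C c) := by
  obtain ⟨𝔓, h𝔓⟩ := w.primesAbove_nonempty
  obtain ⟨σ, hσ⟩ := HeightOneSpectrum.exists_isArithFrobAt_of_mem_primesAbove_holds h𝔓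
  exact ⟨_, charpoly_rankOne ρ σ ▸ h.hasFrobCharpolyAt_charpoly h𝔓 hσ⟩

variable (F₀ F : Type) [Field F₀] [NumberField F₀] [Field F] [NumberField F] [Algebra F₀ F]

/-- `F/F₀` is unramified at all but finitely many places: `e(w ∣ w ∩ 𝓞 F₀) = 1` unless `w` divides
the non-zero relative different (`not_dvd_differentIdeal_iff`, `Ideal.finite_factors`). [folklore] -/
theorem ramificationIdx_eq_one_cofinite :
    ∀ᶠ w : HeightOneSpectrum (𝓞 F) in cofinite, w.asIdeal.ramificationIdx (𝓞 F₀) = 1 := by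
  -- adapted from Literature/NumberTheory/Automorphic/Sweep1BaseChangeGLOne.lean
  have h0 : differentIdeal (𝓞 F₀) (𝓞 F) ≠ ⊥ := differentIdeal_ne_bot
  refine (Ideal.finite_factors h0).subset fun w hw ↦ ?_
  by_contra hnd
  apply hw
  haveI : Algebra.IsUnramifiedAt (𝓞 F₀) w.asIdeal := not_dvd_differentIdeal_iff.mp hnd
  exact Ideal.ramificationIdx_eq_one_of_isUnramifiedAt

/-- A non-zero natural number lies in only finitely many finite places (`Ideal.finite_factors`). [folklore] -/
theorem eventually_natCast_not_mem {q : ℕ} (hq : q ≠ 0) :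
    ∀ᶠ v : HeightOneSpectrum (𝓞 F₀) in cofinite, (q : 𝓞 F₀) ∉ v.asIdeal := by
  -- adapted from Literature/NumberTheory/Automorphic/Sweep1PotentialModularity.lean
  have hne : Ideal.span {(q : 𝓞 F₀)} ≠ ⊥ := by
    rw [Ne, Ideal.span_singleton_eq_bot]
    exact_mod_cast hq
  refine Filter.mem_of_superset (Ideal.finite_factors hne).compl_mem_cofinite ?_
  intro v hv hmem
  exact hv (Ideal.dvd_span_singleton.2 hmem)

variable {F₀ F}

/-- **Guard data exist at all but finitely many places of `F₀`.**  Outside the finitely many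
places above `ℓ` (`eventually_natCast_not_mem`) and below a place of `F` ramified over `F₀`
(`ramificationIdx_eq_one_cofinite`), without Satake parameter (Flath,
`AutomorphicRepData.hasSatakeParamAt_cofinite_holds`) or ramified for the Artin character `eψ`
(`FramedArtinRep.eventually_isUnramifiedAt`), the guard of the crux holds for the family `α` of
Satake parameters and the family `c` of Frobenius values of `eψ` (`exists_hasFrobCharpolyAt_X_sub_C`). [folklore] -/
theorem eventually_exists_guard {n : ℕ} {hcpt : isCompact_glFiniteIntegralLevel n F}
    (π : CuspidalAutomorphicRepData n F hcpt) (eψ : FramedGaloisRep F ℂ 1) (ℓ : ℕ) [Fact ℓ.Prime] :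
    ∀ᶠ v : HeightOneSpectrum (𝓞 F₀) in cofinite, ((ℓ : ℕ) : 𝓞 F₀) ∉ v.asIdeal ∧
      ∃ (α : HeightOneSpectrum (𝓞 F) → Multiset ℂ) (c : HeightOneSpectrum (𝓞 F) → ℂ),
        ∀ w : HeightOneSpectrum (𝓞 F), w.under (𝓞 F₀) = v →
          w.asIdeal.ramificationIdx (𝓞 F₀) = 1 ∧ π.1.HasSatakeParamAt w (α w) ∧
            eψ.IsUnramifiedAt w ∧ eψ.HasFrobCharpolyAt w (X - C (c w)) := by
  classical
  -- global choices: a Satake parameter of `π` and a Frobenius value of `eψ` wherever they exist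
  have hαex : ∀ w : HeightOneSpectrum (𝓞 F), ∃ a : Multiset ℂ,
      π.1.IsUnramifiedAt w → π.1.HasSatakeParamAt w a := by
    intro w
    by_cases hw : π.1.IsUnramifiedAt w
    · obtain ⟨a, ha⟩ := hw
      exact ⟨a, fun _ ↦ ha⟩
    · exact ⟨0, fun h ↦ (hw h).elim⟩
  choose α hα using hαex
  have hcex : ∀ w : HeightOneSpectrum (𝓞 F), ∃ c : ℂ,
      eψ.IsUnramifiedAt w → eψ.HasFrobCharpolyAt w (X - C c) := by
    intro w
    by_cases hw : eψ.IsUnramifiedAt w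
    · obtain ⟨c, hc⟩ := exists_hasFrobCharpolyAt_X_sub_C hw
      exact ⟨c, fun _ ↦ hc⟩
    · exact ⟨0, fun h ↦ (hw h).elim⟩
  choose c hc using hcex
  -- the good places of `F` are cofinite, hence so are the places of `F₀` below only good places
  have hgood : ∀ᶠ w : HeightOneSpectrum (𝓞 F) in cofinite,
      w.asIdeal.ramificationIdx (𝓞 F₀) = 1 ∧ π.1.IsUnramifiedAt w ∧ eψ.IsUnramifiedAt w :=
    (ramificationIdx_eq_one_cofinite F₀ F).and
      ((AutomorphicRepData.hasSatakeParamAt_cofinite_holds π.1).and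
        (FramedArtinRep.eventually_isUnramifiedAt eψ))
  have hbad : {v : HeightOneSpectrum (𝓞 F₀) | ∃ w : HeightOneSpectrum (𝓞 F), w.under (𝓞 F₀) = v ∧
      ¬ (w.asIdeal.ramificationIdx (𝓞 F₀) = 1 ∧ π.1.IsUnramifiedAt w ∧ eψ.IsUnramifiedAt w)}.Finite := by
    refine ((Filter.eventually_cofinite.mp hgood).image fun w ↦ w.under (𝓞 F₀)).subset ?_
    rintro v ⟨w, hwv, hw⟩
    exact ⟨w, hw, hwv⟩
  filter_upwards [eventually_natCast_not_mem F₀ (Fact.out : ℓ.Prime).ne_zero,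
    hbad.compl_mem_cofinite] with v hvℓ hv
  refine ⟨hvℓ, α, c, fun w hw ↦ ?_⟩
  have hw' : w.asIdeal.ramificationIdx (𝓞 F₀) = 1 ∧ π.1.IsUnramifiedAt w ∧ eψ.IsUnramifiedAt w := by
    by_contra hn
    exact hv ⟨w, hw, hn⟩
  exact ⟨hw'.1, hα w hw'.2.1, hw'.2.2, hc w hw'.2.2⟩

end Guard

/-! ### §4 The stub -/

/-- **Stub 6 (`stub_patch`, corrected signature): patching over the CM family and reading off at
every good place.**  Pure Galois theory over `F₀` for the concrete `∅`-general family `F₀(√-D)`,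
`D ∈ QuadraticFamily.GoodPrime F₀ m B` (`m ≠ 0`, `B` finite), and continuous
`r_D : Γ_{F₀(√-D)} → GL_{2n}(ℚ̄_ℓ)` with semisimple underlying representations: IF (control,
almost everywhere, every member) at all but finitely many places `u` of `F₀(√-D)`, whenever
`v = u ∩ F₀ ∤ ℓ` carries a guard family `(α, c)` of the crux, `r_D` is unramified at `u` with
characteristic polynomial `∏_{x root of H_v(α,c)} (X - x^{f(u∣v)})` (`H_v(α,c) = ∏_{w∣v} P_w(X^{f(w∣v)})`
the host polynomial; this is the polynomial of `Frob_u = Frob_v^{f(u∣v)}`), and (coverage) every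
`v ∤ ℓ` carrying a guard family splits in some member with `r_D` unramified with characteristic
polynomial `H_v(α,c)` at ONE place `u ∣ v`, THEN some continuous `R : Γ_{F₀} → GL_{2n}(ℚ̄_ℓ)` with
semisimple underlying representation is unramified with characteristic polynomial `H_v(α,c)` at
EVERY `v ∤ ℓ` carrying a guard family `(α,c)`.  Proof: module docstring (guard families a.e.,
`eventually_exists_guard`; Frobenius datum `E(v) = roots H_v(α⁰_v,c⁰_v)`; Sorensen patching and
one-place read-off, `exists_framedGaloisRep_of_compatibleAE_readOff`).
[cite: Sorensen2020, §1 Lemma 2] [cite: HarrisLanTaylorThorneRMS2016, proof of Cor 7.14] -/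
theorem stub_patch :
    ∀ (F₀ F : Type) [Field F₀] [NumberField F₀] [Field F] [NumberField F] [Algebra F₀ F]
      (n : ℕ) (hcpt : isCompact_glFiniteIntegralLevel n F) (π : CuspidalAutomorphicRepData n F hcpt)
      (ℓ : ℕ) [Fact ℓ.Prime] (ι : PadicAlgCl ℓ ≃+* ℂ) (eψ : FramedGaloisRep F ℂ 1)
      (m : ℕ) (B : Set ℕ), m ≠ 0 → B.Finite →
    ∀ r : ∀ D : QuadraticFamily.GoodPrime F₀ m B,
        FramedGaloisRep (QuadraticFamily.sqrtNegField F₀ D.1) (PadicAlgCl ℓ) (2 * n),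
      (∀ D, (r D).toGaloisRep.IsSemisimple) →
      (∀ D, ∀ᶠ u : HeightOneSpectrum (𝓞 (QuadraticFamily.sqrtNegField F₀ D.1)) in Filter.cofinite,
        ∀ (v : HeightOneSpectrum (𝓞 F₀)) (α : HeightOneSpectrum (𝓞 F) → Multiset ℂ)
          (c : HeightOneSpectrum (𝓞 F) → ℂ), u.under (𝓞 F₀) = v → ((ℓ : ℕ) : 𝓞 F₀) ∉ v.asIdeal →
        (∀ w : HeightOneSpectrum (𝓞 F), w.under (𝓞 F₀) = v → w.asIdeal.ramificationIdx (𝓞 F₀) = 1 ∧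
            π.1.HasSatakeParamAt w (α w) ∧ eψ.IsUnramifiedAt w ∧
            eψ.HasFrobCharpolyAt w (Polynomial.X - Polynomial.C (c w))) →
        (r D).IsUnramifiedAt u ∧ (r D).HasFrobCharpolyAt u
          (((∏ᶠ w ∈ {w : HeightOneSpectrum (𝓞 F) | w.under (𝓞 F₀) = v},
              Polynomial.expand (PadicAlgCl ℓ) (w.asIdeal.inertiaDeg (𝓞 F₀))
                (arithFrobPolyOfSatake ι w.residueCard n ((α w).map (fun a ↦ a * c w)))).roots.map
            (fun x ↦ Polynomial.X - Polynomial.C (x ^ u.asIdeal.inertiaDeg (𝓞 F₀)))).prod)) →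
      (∀ (v : HeightOneSpectrum (𝓞 F₀)) (α : HeightOneSpectrum (𝓞 F) → Multiset ℂ)
          (c : HeightOneSpectrum (𝓞 F) → ℂ), ((ℓ : ℕ) : 𝓞 F₀) ∉ v.asIdeal →
        (∀ w : HeightOneSpectrum (𝓞 F), w.under (𝓞 F₀) = v → w.asIdeal.ramificationIdx (𝓞 F₀) = 1 ∧
            π.1.HasSatakeParamAt w (α w) ∧ eψ.IsUnramifiedAt w ∧
            eψ.HasFrobCharpolyAt w (Polynomial.X - Polynomial.C (c w))) →
        ∃ D : QuadraticFamily.GoodPrime F₀ m B,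
          (v.asIdeal.primesOver (𝓞 (QuadraticFamily.sqrtNegField F₀ D.1))).ncard = 2 ∧
          ∃ u : HeightOneSpectrum (𝓞 (QuadraticFamily.sqrtNegField F₀ D.1)), u.under (𝓞 F₀) = v ∧
            (r D).IsUnramifiedAt u ∧ (r D).HasFrobCharpolyAt u
              (∏ᶠ w ∈ {w : HeightOneSpectrum (𝓞 F) | w.under (𝓞 F₀) = v},
              Polynomial.expand (PadicAlgCl ℓ) (w.asIdeal.inertiaDeg (𝓞 F₀))
                (arithFrobPolyOfSatake ι w.residueCard n ((α w).map (fun a ↦ a * c w))))) →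
    ∃ R : FramedGaloisRep F₀ (PadicAlgCl ℓ) (2 * n), R.toGaloisRep.IsSemisimple ∧
      ∀ (v : HeightOneSpectrum (𝓞 F₀)) (α : HeightOneSpectrum (𝓞 F) → Multiset ℂ)
          (c : HeightOneSpectrum (𝓞 F) → ℂ), ((ℓ : ℕ) : 𝓞 F₀) ∉ v.asIdeal →
        (∀ w : HeightOneSpectrum (𝓞 F), w.under (𝓞 F₀) = v → w.asIdeal.ramificationIdx (𝓞 F₀) = 1 ∧
            π.1.HasSatakeParamAt w (α w) ∧ eψ.IsUnramifiedAt w ∧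
            eψ.HasFrobCharpolyAt w (Polynomial.X - Polynomial.C (c w))) →
        R.IsUnramifiedAt v ∧ R.HasFrobCharpolyAt v
          (∏ᶠ w ∈ {w : HeightOneSpectrum (𝓞 F) | w.under (𝓞 F₀) = v},
              Polynomial.expand (PadicAlgCl ℓ) (w.asIdeal.inertiaDeg (𝓞 F₀))
                (arithFrobPolyOfSatake ι w.residueCard n ((α w).map (fun a ↦ a * c w)))) := by
  intro F₀ F _ _ _ _ _ n hcpt π ℓ _ ι eψ m B hm hB r hss hctrl hcov
  classical
  -- the guard of the crux, as a predicate
  let Gd : HeightOneSpectrum (𝓞 F₀) → (HeightOneSpectrum (𝓞 F) → Multiset ℂ) →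
      (HeightOneSpectrum (𝓞 F) → ℂ) → Prop := fun v α c ↦
    ∀ w : HeightOneSpectrum (𝓞 F), w.under (𝓞 F₀) = v → w.asIdeal.ramificationIdx (𝓞 F₀) = 1 ∧
      π.1.HasSatakeParamAt w (α w) ∧ eψ.IsUnramifiedAt w ∧ eψ.HasFrobCharpolyAt w (X - C (c w))
  -- one guard family at every place of `F₀`, genuine wherever one exists
  have hex : ∀ v, ∃ α c, (∃ α' c', Gd v α' c') → Gd v α c := fun v ↦ by
    by_cases h : ∃ α' c', Gd v α' c'
    · obtain ⟨α, c, h⟩ := h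
      exact ⟨α, c, fun _ ↦ h⟩
    · exact ⟨fun _ ↦ 0, fun _ ↦ 0, fun h' ↦ (h h').elim⟩
  choose α₀ c₀ hαc₀ using hex
  -- the Frobenius datum on `F₀`: the roots of the host polynomial of the chosen guard family
  set E : HeightOneSpectrum (𝓞 F₀) → Multiset (PadicAlgCl ℓ) := fun v ↦
    (∏ᶠ w ∈ {w : HeightOneSpectrum (𝓞 F) | w.under (𝓞 F₀) = v},
      Polynomial.expand (PadicAlgCl ℓ) (w.asIdeal.inertiaDeg (𝓞 F₀))
        (arithFrobPolyOfSatake ι w.residueCard n ((α₀ v w).map (fun a ↦ a * c₀ v w)))).roots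
    with hE
  -- every member is compatible almost everywhere with `E` (control + guard families a.e.)
  have hcomp : ∀ D, CompatibleAE E (r D) := by
    intro D
    have hG : ∀ᶠ u : HeightOneSpectrum (𝓞 (QuadraticFamily.sqrtNegField F₀ D.1)) in cofinite,
        ((ℓ : ℕ) : 𝓞 F₀) ∉ (u.under (𝓞 F₀)).asIdeal ∧ ∃ α' c', Gd (u.under (𝓞 F₀)) α' c' := by
      have h := eventually_exists_guard (F₀ := F₀) π eψ ℓ
      rw [Filter.eventually_cofinite] at h ⊢
      exact h.preimage'
        (f := fun u : HeightOneSpectrum (𝓞 (QuadraticFamily.sqrtNegField F₀ D.1)) ↦ u.under (𝓞 F₀))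
        fun v _ ↦ finite_setOf_under_eq v
    filter_upwards [hctrl D, hG] with u hu h
    obtain ⟨h1, h2⟩ := hu (u.under (𝓞 F₀)) (α₀ _) (c₀ _) rfl h.1 (hαc₀ _ h.2)
    refine ⟨h1, ?_⟩
    rw [frobPoly, hE]
    exact h2
  -- patch, and read off at one place above each good `v` through a member in which `v` splits
  obtain ⟨R, hRss, -, hR⟩ := exists_framedGaloisRep_of_compatibleAE_readOff hm hB E r hss hcomp
  refine ⟨R, hRss, fun v α c hℓ hG ↦ ?_⟩
  obtain ⟨D, hsplit, u, huv, hunr, hQ⟩ := hcov v α c hℓ hG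
  exact hR D v u _ hsplit huv hunr hQ

end Summit.Langlands.Langlands.Theorems.HostInducedRep.OneTransparentPane
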